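import Mathlib
import Summits.NavierStokesRegularity.NavierStokesRegularity.Theorems.FilamentSkeletonRssStadiumQuarterDescentMargin
import Summits.NavierStokesRegularity.NavierStokesRegularity.Theorems.FilamentSkeletonRssStadiumBaseMargin
import Summits.NavierStokesRegularity.NavierStokesRegularity.Theorems.FilamentSkeletonRssStadiumKernelPieces

/-!
# Route `FilamentSkeletonRss` · cruxes `SkeletonJ1L` (stmt-NavierStokesRegularity-23296, registered stub `stub_tangentSkeletonL` ≡
# `TangentSkeletonNearStraightL`, stmt-23320) · line `child_tangent_analytic_strip_L` (b0b56c52900dd90a), stub `stub_stripPropagation` —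
# brick for the BOUND clause of `rcore`: THE TWO DESCENTS OF THE SYMMETRIC QUARTER-WIDTH TENT ARE `O(1/hs)`

With the margin `(0.007hs)² ≤ Re Σᵢ (Fᵢ z₀ − Fᵢ ζ)²` along both sloped segments of the symmetric tent (`Theorems.StadiumQuarterDescentMargin`,
every anchor of the quarter stadium, tent orientation on the left), the kernel of target `z₀` is bounded there by
`((0.007hs)²)^{-3/2}·8·‖z₀ − ζ‖` (`descent_kernel_norm_le`: `‖(D^{3/2})⁻¹‖ ≤ (Re D)^{-3/2}`, `‖F′ × (F z₀ − F ζ)‖ ≤ 2·2·2‖z₀ − ζ‖` by the mean value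
theorem on the convex stadium), so each sloped segment integral is `≤ ((0.007hs)²)^{-3/2}·(8hs)·hs` (`right_descent_segment_norm_le`,
`left_ascent_segment_norm_le`) — the descent part of the explicit own-term bound of `rcore`, `O(1/hs)`.
HONEST FRAMING: a brick for the bookkeeping of a HYPOTHETICAL filament skeleton on the NEGATIVE side of a MODEL route; the stub `stub_stripPropagation`
is NOT closed by this file, `TangentSkeletonNearStraightL` / `SkeletonJ1L` stay OPEN; nothing here bears on Navier–Stokes regularity or blow-up.
`--supports stmt-NavierStokesRegularity-23320` (≡ stub `stub_tangentSkeletonL` of 23296).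
-/

set_option linter.dupNamespace false

noncomputable section

namespace Summit.NavierStokesRegularity.NavierStokesRegularity.Theorems.StadiumQuarterDescentBound

open Set Complex MeasureTheory
open scoped InnerProductSpace Matrix Interval
open Summit.NavierStokesRegularity.NavierStokesRegularity.Theorems.StadiumQuarterDescentMargin
open Summit.NavierStokesRegularity.NavierStokesRegularity.Theorems.StadiumBaseMargin
open Summit.NavierStokesRegularity.NavierStokesRegularity.Theorems.StadiumKernelPieces
open Summit.NavierStokesRegularity.NavierStokesRegularity.Theorems.StadiumChordCrude
open Summit.NavierStokesRegularity.NavierStokesRegularity.Theorems.StadiumPartnerPiece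

/-- **Kernel bound from a margin.**  `F` holomorphic on the stadium with `‖F′‖ ≤ 2`, target `z` and source `ζ` in the stadium, a margin
`0 < m ≤ Re Σᵢ (Fᵢ z − Fᵢ ζ)²`, a core term of non-negative real part, `κ ≥ 0`: the kernel of target `z` at `ζ` has norm `≤ m^{-3/2}·(8‖z − ζ‖)`. [folklore] -/
theorem descent_kernel_norm_le {hs L cc : ℝ} {F : ℂ → (Fin 3 → ℂ)}
    (hF : DifferentiableOn ℂ F {z : ℂ | |z.im| < hs ∧ |z.re - cc| < L + hs})
    (hM : ∀ z ∈ {z : ℂ | |z.im| < hs ∧ |z.re - cc| < L + hs}, ‖deriv F z‖ ≤ 2)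
    {G : ℂ → ℂ} {κ : ℝ} (hκ : 0 ≤ κ) {z ζ : ℂ} (hz : z ∈ {z : ℂ | |z.im| < hs ∧ |z.re - cc| < L + hs})
    (hζ : ζ ∈ {z : ℂ | |z.im| < hs ∧ |z.re - cc| < L + hs}) (hGre : 0 ≤ (G ζ).re)
    {m : ℝ} (hm : 0 < m) (hmargin : m ≤ (∑ i, (F z i - F ζ i) ^ 2).re) :
    ‖(((∑ i, (F z i - F ζ i) ^ 2) + (κ : ℂ) * G ζ) ^ ((3:ℂ) / 2))⁻¹ • (deriv F ζ ⨯₃ (fun i => F z i - F ζ i))‖ ≤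
      m ^ (-(3/2 : ℝ)) * (8 * ‖z - ζ‖) := by
  set S : Set ℂ := {z : ℂ | |z.im| < hs ∧ |z.re - cc| < L + hs} with hS
  have hSo : IsOpen S := isOpen_stadium hs (L + hs) cc
  set D : ℂ := (∑ i, (F z i - F ζ i) ^ 2) + (κ : ℂ) * G ζ with hD
  have hDre : m ≤ D.re := by
    have h1 : D.re = (∑ i, (F z i - F ζ i) ^ 2).re + κ * (G ζ).re := by
      rw [hD, Complex.add_re, Complex.re_ofReal_mul]
    rw [h1]; nlinarith [mul_nonneg hκ hGre]
  have hDpos : 0 < D.re := lt_of_lt_of_le hm hDre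
  have h1 : ‖(D ^ ((3:ℂ) / 2))⁻¹‖ ≤ m ^ (-(3/2 : ℝ)) :=
    (norm_inv_cpow_threeHalves_le hDpos).trans (Real.rpow_le_rpow_of_nonpos hm hDre (by norm_num))
  -- mean value on the segment `[ζ, z] ⊆ S`
  have hsegS : segment ℝ ζ z ⊆ S := (stadium_convex hs L cc).segment_subset hζ hz
  have hlip : ‖F z - F ζ‖ ≤ 2 * ‖z - ζ‖ :=
    norm_sub_le_of_segment (fun w hw => hF.differentiableAt (hSo.mem_nhds (hsegS hw))) (fun w hw => hM w (hsegS hw))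
  have h2 : ‖deriv F ζ ⨯₃ (fun i => F z i - F ζ i)‖ ≤ 8 * ‖z - ζ‖ := by
    have e : (fun i => F z i - F ζ i) = F z - F ζ := by funext i; simp [Pi.sub_apply]
    rw [e]
    calc ‖deriv F ζ ⨯₃ (F z - F ζ)‖ ≤ 2 * ‖deriv F ζ‖ * ‖F z - F ζ‖ := norm_crossProduct_le _ _
      _ ≤ 2 * 2 * (2 * ‖z - ζ‖) := by
          apply mul_le_mul (mul_le_mul_of_nonneg_left (hM ζ hζ) (by norm_num)) hlip (norm_nonneg _) (by norm_num)
      _ = 8 * ‖z - ζ‖ := by ring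
  rw [norm_smul]
  exact mul_le_mul h1 h2 (norm_nonneg _) (Real.rpow_nonneg hm.le _)

/-- **The right descent of every anchor of the quarter stadium is `O(1/hs)`** (segment `z₀ + hs/5 → x₀ + hs/2`; core of non-negative real part,
`κ ≥ 0`). [folklore] -/
theorem right_descent_segment_norm_le {hs L cc : ℝ} {F : ℂ → (Fin 3 → ℂ)}
    (hF : DifferentiableOn ℂ F {z : ℂ | |z.im| < hs ∧ |z.re - cc| < L + hs})
    (hM : ∀ z ∈ {z : ℂ | |z.im| < hs ∧ |z.re - cc| < L + hs}, ‖deriv F z‖ ≤ 2)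
    (hunit : ∀ w ∈ {z : ℂ | |z.im| < hs ∧ |z.re - cc| < L + hs}, ∑ i, (deriv F w i) ^ 2 = 1)
    {X : ℝ → EuclideanSpace ℝ (Fin 3)} (hX : ContDiff ℝ 1 X) (hXu : ∀ τ, ‖deriv X τ‖ = 1)
    {Rb : ℝ} (hRb0 : 0 ≤ Rb) (hRb : Rb ≤ 1 / 2) (hosc : ∀ τ σ, ‖deriv X τ - deriv X σ‖ ≤ Rb)
    (hFX : ∀ r : ℝ, (r : ℂ) ∈ {z : ℂ | |z.im| < hs ∧ |z.re - cc| < L + hs} →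
      F r = fun i => ((⟪X r, EuclideanSpace.single i (1:ℝ)⟫_ℝ : ℝ) : ℂ))
    (hhs : 0 < hs) {x₀ Y₀ : ℝ} (hY : |Y₀| < hs / 4) (hx₀ : |x₀ - cc| < L + hs / 4)
    {G : ℂ → ℂ} {κ : ℝ} (hκ : 0 ≤ κ) (hGre : ∀ w ∈ {z : ℂ | |z.im| < hs ∧ |z.re - cc| < L + hs}, 0 ≤ (G w).re) :
    ‖∫ t in (0:ℝ)..1, (((x₀ + hs / 2 : ℝ) : ℂ) - (((x₀ + hs / 5 : ℝ) : ℂ) + (Y₀ : ℂ) * Complex.I)) •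
        ((((∑ i, (F ((x₀ : ℂ) + (Y₀ : ℂ) * Complex.I) i -
              F ((((x₀ + hs / 5 : ℝ) : ℂ) + (Y₀ : ℂ) * Complex.I) + (t : ℂ) *
                (((x₀ + hs / 2 : ℝ) : ℂ) - (((x₀ + hs / 5 : ℝ) : ℂ) + (Y₀ : ℂ) * Complex.I))) i) ^ 2) +
            (κ : ℂ) * G ((((x₀ + hs / 5 : ℝ) : ℂ) + (Y₀ : ℂ) * Complex.I) + (t : ℂ) *
                (((x₀ + hs / 2 : ℝ) : ℂ) - (((x₀ + hs / 5 : ℝ) : ℂ) + (Y₀ : ℂ) * Complex.I)))) ^ ((3:ℂ) / 2))⁻¹ •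
          (deriv F ((((x₀ + hs / 5 : ℝ) : ℂ) + (Y₀ : ℂ) * Complex.I) + (t : ℂ) *
                (((x₀ + hs / 2 : ℝ) : ℂ) - (((x₀ + hs / 5 : ℝ) : ℂ) + (Y₀ : ℂ) * Complex.I))) ⨯₃
            (fun i => F ((x₀ : ℂ) + (Y₀ : ℂ) * Complex.I) i -
              F ((((x₀ + hs / 5 : ℝ) : ℂ) + (Y₀ : ℂ) * Complex.I) + (t : ℂ) *
                (((x₀ + hs / 2 : ℝ) : ℂ) - (((x₀ + hs / 5 : ℝ) : ℂ) + (Y₀ : ℂ) * Complex.I))) i)))‖ ≤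
      ((0.007 * hs) ^ 2) ^ (-(3/2 : ℝ)) * (8 * hs) * hs := by
  set S : Set ℂ := {z : ℂ | |z.im| < hs ∧ |z.re - cc| < L + hs} with hS
  set z₀ : ℂ := (x₀ : ℂ) + (Y₀ : ℂ) * Complex.I with hz₀
  set p : ℂ := ((x₀ + hs / 5 : ℝ) : ℂ) + (Y₀ : ℂ) * Complex.I with hp
  set q : ℂ := ((x₀ + hs / 2 : ℝ) : ℂ) with hq
  have hY' := abs_lt.mp hY
  have hx' := abs_lt.mp hx₀
  have hm : (0:ℝ) < (0.007 * hs) ^ 2 := by positivity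
  have hz₀S : z₀ ∈ S := by
    refine ⟨?_, ?_⟩
    · simp [hz₀]; rw [abs_lt]; constructor <;> linarith
    · simp [hz₀]; rw [abs_lt]; constructor <;> linarith
  have hmar := right_descent_re_ge_general hF hM hunit hX hXu hRb0 hRb hosc hFX hhs hY hx₀
  -- the segment length and the target–source distances are `≤ hs`
  have hqp : ‖q - p‖ ≤ hs := by
    have e : q - p = ((3 * hs / 10 : ℝ) : ℂ) + ((-Y₀ : ℝ) : ℂ) * Complex.I := by
      simp only [hq, hp]; push_cast; ring
    rw [e]
    refine (Complex.norm_le_abs_re_add_abs_im _).trans ?_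
    simp
    rw [abs_of_pos (by positivity : (0:ℝ) < 3 * hs / 10)]
    linarith [abs_nonneg Y₀, abs_neg Y₀]
  have hpt : ∀ t ∈ Icc (0:ℝ) 1, p + (t : ℂ) * (q - p) ∈ S ∧ ‖z₀ - (p + (t : ℂ) * (q - p))‖ ≤ hs := by
    intro t ht
    have e : p + (t : ℂ) * (q - p) = (((x₀ + (hs / 5 + 3 * hs / 10 * t)) : ℝ) : ℂ) + ((Y₀ * (1 - t) : ℝ) : ℂ) * Complex.I := by
      simp only [hp, hq]; push_cast; ring
    have h1t : |1 - t| ≤ 1 := by rw [abs_le]; constructor <;> linarith [ht.1, ht.2]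
    have hYt : |Y₀ * (1 - t)| ≤ |Y₀| := by
      rw [abs_mul]; exact mul_le_of_le_one_right (abs_nonneg _) h1t
    refine ⟨?_, ?_⟩
    · rw [e]
      refine ⟨?_, ?_⟩
      · simp only [Complex.add_im, Complex.ofReal_im, Complex.mul_im, Complex.ofReal_re, Complex.I_re, Complex.I_im,
          mul_zero, mul_one, zero_add, add_zero]
        linarith
      · simp only [Complex.add_re, Complex.ofReal_re, Complex.mul_re, Complex.ofReal_im, Complex.I_re, Complex.I_im,
          mul_zero, mul_one, sub_zero, add_zero]
        rw [abs_lt]; constructor <;> nlinarith [ht.1, ht.2]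
    · have e2 : z₀ - (p + (t : ℂ) * (q - p)) = ((-(hs / 5 + 3 * hs / 10 * t) : ℝ) : ℂ) + ((Y₀ * t : ℝ) : ℂ) * Complex.I := by
        rw [e]; simp only [hz₀]; push_cast; ring
      rw [e2]
      refine (Complex.norm_le_abs_re_add_abs_im _).trans ?_
      simp only [Complex.add_re, Complex.ofReal_re, Complex.mul_re, Complex.ofReal_im, Complex.I_re, Complex.I_im,
        mul_zero, mul_one, sub_zero, add_zero, Complex.add_im, Complex.mul_im, zero_add]
      rw [abs_neg, abs_of_nonneg (by nlinarith [ht.1] : (0:ℝ) ≤ hs / 5 + 3 * hs / 10 * t), abs_mul,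
        abs_of_nonneg ht.1]
      nlinarith [abs_nonneg Y₀, ht.1, ht.2, mul_le_mul_of_nonneg_left ht.2 (abs_nonneg Y₀)]
  -- pointwise bound and integration
  have hbound : ∀ t ∈ Ι (0:ℝ) 1, ‖(q - p) • ((((∑ i, (F z₀ i - F (p + (t : ℂ) * (q - p)) i) ^ 2) +
        (κ : ℂ) * G (p + (t : ℂ) * (q - p))) ^ ((3:ℂ) / 2))⁻¹ •
      (deriv F (p + (t : ℂ) * (q - p)) ⨯₃ (fun i => F z₀ i - F (p + (t : ℂ) * (q - p)) i)))‖ ≤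
      ((0.007 * hs) ^ 2) ^ (-(3/2 : ℝ)) * (8 * hs) * hs := by
    intro t ht
    rw [Set.uIoc_of_le zero_le_one] at ht
    have ht' : t ∈ Icc (0:ℝ) 1 := ⟨ht.1.le, ht.2⟩
    obtain ⟨hζS, hdist⟩ := hpt t ht'
    have hk := descent_kernel_norm_le hF hM hκ hz₀S hζS (hGre _ hζS) hm (hmar t ht')
    rw [norm_smul]
    have hpow0 : 0 ≤ ((0.007 * hs) ^ 2) ^ (-(3/2 : ℝ)) := Real.rpow_nonneg hm.le _
    calc ‖q - p‖ * ‖(((∑ i, (F z₀ i - F (p + (t : ℂ) * (q - p)) i) ^ 2) + (κ : ℂ) * G (p + (t : ℂ) * (q - p))) ^ ((3:ℂ) / 2))⁻¹ •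
          (deriv F (p + (t : ℂ) * (q - p)) ⨯₃ (fun i => F z₀ i - F (p + (t : ℂ) * (q - p)) i))‖
        ≤ hs * (((0.007 * hs) ^ 2) ^ (-(3/2 : ℝ)) * (8 * ‖z₀ - (p + (t : ℂ) * (q - p))‖)) :=
          mul_le_mul hqp hk (norm_nonneg _) hhs.le
      _ ≤ hs * (((0.007 * hs) ^ 2) ^ (-(3/2 : ℝ)) * (8 * hs)) := by
          apply mul_le_mul_of_nonneg_left _ hhs.le
          exact mul_le_mul_of_nonneg_left (by linarith) hpow0
      _ = ((0.007 * hs) ^ 2) ^ (-(3/2 : ℝ)) * (8 * hs) * hs := by ring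
  have h := intervalIntegral.norm_integral_le_of_norm_le_const hbound
  simpa using h

/-- **The left ascent of every anchor of the quarter stadium is `O(1/hs)`** (segment `x₀ − hs/2 → (x₀ − hs/5) + iY₀`, tent orientation). [folklore] -/
theorem left_ascent_segment_norm_le {hs L cc : ℝ} {F : ℂ → (Fin 3 → ℂ)}
    (hF : DifferentiableOn ℂ F {z : ℂ | |z.im| < hs ∧ |z.re - cc| < L + hs})
    (hM : ∀ z ∈ {z : ℂ | |z.im| < hs ∧ |z.re - cc| < L + hs}, ‖deriv F z‖ ≤ 2)
    (hunit : ∀ w ∈ {z : ℂ | |z.im| < hs ∧ |z.re - cc| < L + hs}, ∑ i, (deriv F w i) ^ 2 = 1)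
    {X : ℝ → EuclideanSpace ℝ (Fin 3)} (hX : ContDiff ℝ 1 X) (hXu : ∀ τ, ‖deriv X τ‖ = 1)
    {Rb : ℝ} (hRb0 : 0 ≤ Rb) (hRb : Rb ≤ 1 / 2) (hosc : ∀ τ σ, ‖deriv X τ - deriv X σ‖ ≤ Rb)
    (hFX : ∀ r : ℝ, (r : ℂ) ∈ {z : ℂ | |z.im| < hs ∧ |z.re - cc| < L + hs} →
      F r = fun i => ((⟪X r, EuclideanSpace.single i (1:ℝ)⟫_ℝ : ℝ) : ℂ))
    (hhs : 0 < hs) {x₀ Y₀ : ℝ} (hY : |Y₀| < hs / 4) (hx₀ : |x₀ - cc| < L + hs / 4)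
    {G : ℂ → ℂ} {κ : ℝ} (hκ : 0 ≤ κ) (hGre : ∀ w ∈ {z : ℂ | |z.im| < hs ∧ |z.re - cc| < L + hs}, 0 ≤ (G w).re) :
    ‖∫ t in (0:ℝ)..1, ((((x₀ - hs / 5 : ℝ) : ℂ) + (Y₀ : ℂ) * Complex.I) - ((x₀ - hs / 2 : ℝ) : ℂ)) •
        ((((∑ i, (F ((x₀ : ℂ) + (Y₀ : ℂ) * Complex.I) i -
              F (((x₀ - hs / 2 : ℝ) : ℂ) + (t : ℂ) *
                ((((x₀ - hs / 5 : ℝ) : ℂ) + (Y₀ : ℂ) * Complex.I) - ((x₀ - hs / 2 : ℝ) : ℂ))) i) ^ 2) +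
            (κ : ℂ) * G (((x₀ - hs / 2 : ℝ) : ℂ) + (t : ℂ) *
                ((((x₀ - hs / 5 : ℝ) : ℂ) + (Y₀ : ℂ) * Complex.I) - ((x₀ - hs / 2 : ℝ) : ℂ)))) ^ ((3:ℂ) / 2))⁻¹ •
          (deriv F (((x₀ - hs / 2 : ℝ) : ℂ) + (t : ℂ) *
                ((((x₀ - hs / 5 : ℝ) : ℂ) + (Y₀ : ℂ) * Complex.I) - ((x₀ - hs / 2 : ℝ) : ℂ))) ⨯₃
            (fun i => F ((x₀ : ℂ) + (Y₀ : ℂ) * Complex.I) i -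
              F (((x₀ - hs / 2 : ℝ) : ℂ) + (t : ℂ) *
                ((((x₀ - hs / 5 : ℝ) : ℂ) + (Y₀ : ℂ) * Complex.I) - ((x₀ - hs / 2 : ℝ) : ℂ))) i)))‖ ≤
      ((0.007 * hs) ^ 2) ^ (-(3/2 : ℝ)) * (8 * hs) * hs := by
  set S : Set ℂ := {z : ℂ | |z.im| < hs ∧ |z.re - cc| < L + hs} with hS
  set z₀ : ℂ := (x₀ : ℂ) + (Y₀ : ℂ) * Complex.I with hz₀
  set p : ℂ := ((x₀ - hs / 2 : ℝ) : ℂ) with hp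
  set q : ℂ := ((x₀ - hs / 5 : ℝ) : ℂ) + (Y₀ : ℂ) * Complex.I with hq
  have hY' := abs_lt.mp hY
  have hx' := abs_lt.mp hx₀
  have hm : (0:ℝ) < (0.007 * hs) ^ 2 := by positivity
  have hz₀S : z₀ ∈ S := by
    refine ⟨?_, ?_⟩
    · simp [hz₀]; rw [abs_lt]; constructor <;> linarith
    · simp [hz₀]; rw [abs_lt]; constructor <;> linarith
  have hmar := left_ascent_re_ge_general hF hM hunit hX hXu hRb0 hRb hosc hFX hhs hY hx₀
  have hqp : ‖q - p‖ ≤ hs := by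
    have e : q - p = ((3 * hs / 10 : ℝ) : ℂ) + ((Y₀ : ℝ) : ℂ) * Complex.I := by
      simp only [hq, hp]; push_cast; ring
    rw [e]
    refine (Complex.norm_le_abs_re_add_abs_im _).trans ?_
    simp
    rw [abs_of_pos (by positivity : (0:ℝ) < 3 * hs / 10)]
    linarith [abs_nonneg Y₀]
  have hpt : ∀ t ∈ Icc (0:ℝ) 1, p + (t : ℂ) * (q - p) ∈ S ∧ ‖z₀ - (p + (t : ℂ) * (q - p))‖ ≤ hs := by
    intro t ht
    have e : p + (t : ℂ) * (q - p) = (((x₀ - hs / 2 + 3 * hs / 10 * t) : ℝ) : ℂ) + ((Y₀ * t : ℝ) : ℂ) * Complex.I := by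
      simp only [hp, hq]; push_cast; ring
    refine ⟨?_, ?_⟩
    · rw [e]
      refine ⟨?_, ?_⟩
      · simp only [Complex.add_im, Complex.ofReal_im, Complex.mul_im, Complex.ofReal_re, Complex.I_re, Complex.I_im,
          mul_zero, mul_one, zero_add, add_zero]
        rw [abs_mul]
        calc |Y₀| * |t| ≤ |Y₀| * 1 := mul_le_mul_of_nonneg_left (by rw [abs_le]; constructor <;> linarith [ht.1, ht.2]) (abs_nonneg _)
          _ < hs := by linarith
      · simp only [Complex.add_re, Complex.ofReal_re, Complex.mul_re, Complex.ofReal_im, Complex.I_re, Complex.I_im,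
          mul_zero, mul_one, sub_zero, add_zero]
        rw [abs_lt]; constructor <;> nlinarith [ht.1, ht.2]
    · have e2 : z₀ - (p + (t : ℂ) * (q - p)) = (((hs / 2 - 3 * hs / 10 * t) : ℝ) : ℂ) + ((Y₀ * (1 - t) : ℝ) : ℂ) * Complex.I := by
        rw [e]; simp only [hz₀]; push_cast; ring
      rw [e2]
      refine (Complex.norm_le_abs_re_add_abs_im _).trans ?_
      simp only [Complex.add_re, Complex.ofReal_re, Complex.mul_re, Complex.ofReal_im, Complex.I_re, Complex.I_im,
        mul_zero, mul_one, sub_zero, add_zero, Complex.add_im, Complex.mul_im, zero_add]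
      rw [abs_of_nonneg (by nlinarith [ht.2] : (0:ℝ) ≤ hs / 2 - 3 * hs / 10 * t), abs_mul,
        abs_of_nonneg (by linarith [ht.2] : (0:ℝ) ≤ 1 - t)]
      nlinarith [abs_nonneg Y₀, ht.1, ht.2, mul_le_mul_of_nonneg_left (by linarith [ht.1] : 1 - t ≤ 1) (abs_nonneg Y₀)]
  have hbound : ∀ t ∈ Ι (0:ℝ) 1, ‖(q - p) • ((((∑ i, (F z₀ i - F (p + (t : ℂ) * (q - p)) i) ^ 2) +
        (κ : ℂ) * G (p + (t : ℂ) * (q - p))) ^ ((3:ℂ) / 2))⁻¹ •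
      (deriv F (p + (t : ℂ) * (q - p)) ⨯₃ (fun i => F z₀ i - F (p + (t : ℂ) * (q - p)) i)))‖ ≤
      ((0.007 * hs) ^ 2) ^ (-(3/2 : ℝ)) * (8 * hs) * hs := by
    intro t ht
    rw [Set.uIoc_of_le zero_le_one] at ht
    have ht' : t ∈ Icc (0:ℝ) 1 := ⟨ht.1.le, ht.2⟩
    obtain ⟨hζS, hdist⟩ := hpt t ht'
    have hk := descent_kernel_norm_le hF hM hκ hz₀S hζS (hGre _ hζS) hm (hmar t ht')
    rw [norm_smul]
    have hpow0 : 0 ≤ ((0.007 * hs) ^ 2) ^ (-(3/2 : ℝ)) := Real.rpow_nonneg hm.le _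
    calc ‖q - p‖ * ‖(((∑ i, (F z₀ i - F (p + (t : ℂ) * (q - p)) i) ^ 2) + (κ : ℂ) * G (p + (t : ℂ) * (q - p))) ^ ((3:ℂ) / 2))⁻¹ •
          (deriv F (p + (t : ℂ) * (q - p)) ⨯₃ (fun i => F z₀ i - F (p + (t : ℂ) * (q - p)) i))‖
        ≤ hs * (((0.007 * hs) ^ 2) ^ (-(3/2 : ℝ)) * (8 * ‖z₀ - (p + (t : ℂ) * (q - p))‖)) :=
          mul_le_mul hqp hk (norm_nonneg _) hhs.le
      _ ≤ hs * (((0.007 * hs) ^ 2) ^ (-(3/2 : ℝ)) * (8 * hs)) := by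
          apply mul_le_mul_of_nonneg_left _ hhs.le
          exact mul_le_mul_of_nonneg_left (by linarith) hpow0
      _ = ((0.007 * hs) ^ 2) ^ (-(3/2 : ℝ)) * (8 * hs) * hs := by ring
  have h := intervalIntegral.norm_integral_le_of_norm_le_const hbound
  simpa using h

end Summit.NavierStokesRegularity.NavierStokesRegularity.Theorems.StadiumQuarterDescentBound

end
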